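import Summits.BirchSwinnertonDyer.BirchSwinnertonDyer.Theorems.KatoDescentPotSupersingularReducibleFineSelmerKatoH2Descent
import Literature.NumberTheory.EllipticCurves.Kato2004.IwasawaH2DescentRankOne
import HarnessLib

/-!
# The KATO-H2 socket on the tree's `IwasawaH2Data` packages: (14.14.1) supplies the count `#𝐇²[T] = #desc` by name, so
# `#(𝐇²/T·𝐇²) ∣ [H¹(ℤ[1/p],T_pW) : ℤ_p s₀]` for EVERY descent package whose `H2` receives `X₀(W/ℚ_∞)` with finite cokernel
# (route `KatoDescentPotSupersingular` / `…Tame…`, crux M = stmt-BirchSwinnertonDyer-19196; route-free helper)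

Seat `bsd-potss-rkm` g18 (prover; cell `bsd-potss`), item stmt-BirchSwinnertonDyer-19196 (`--supports … --as helper`; closes
nothing).  HONEST FRAMING: BSD is not proved by any of this; nothing is booked; theorems only (no definition, no named fact).

Sequel of `…ReducibleFineSelmerKatoH2Descent` (the socket for an abstract `H2` with the (14.14.1) count as a hypothesis).  The tree's
descent package `Kato2004.IwasawaH2Data W p κ γ I` (Kato (12.2.1), Thm. 12.4 (1), (14.14.1) on the cyclotomic pin; inhabited on every row,
`nonempty_iwasawaH2Data_holds`, and produced by the held zeta package, `MemberHullZetaInputs.toIwasawaH2Data`) carries (14.14.1) as DATA: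
`descentCokernelEquiv : desc ≃+ J.H2[T]`.  Hence:

* `natCard_invariants_H2_eq_natCard_descentCokernel` — **`#J.H2[T] = #(H¹(ℤ[1/p],T_pW)/proj₀(𝐇¹_Γ/T))`** on every package;
* **`natCard_coinvariants_H2_dvd_index_of_embedding`** — on a rank-0 row with the cyclotomic pin, a fine dual datum `Y` with
  `Sel₀(W/ℚ_∞)[p]` finite, a class `s` with `proj₀ s` non-torsion and `char_Λ(𝐇¹_Γ/Λs) ⊆ char_Λ X₀`, and a package `J` with an
  injective `Λ`-linear `X₀ → J.H2` of finite cokernel: **`#(J.H2/T·J.H2) ∣ [H¹(ℤ[1/p],T_pW) : ℤ_p s₀]`** — Kato's Thm. 14.5 (3) in the form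
  `#𝐇²_Γ ≤ [A : z]`, with NO parasitic term.  What a package does NOT pin: that `J.H2` IS Kato's `𝐇²(T_pW)`; the two inputs the exact
  node still needs from the genuine `𝐇²` are exactly (i) `X₀ ↪ 𝐇²` with finite cokernel (Λ-adic Poitou–Tate at a potentially good `p`) and
  (ii) `#(𝐇²/T) = #H²(ℤ[1/p],T_pW) = #Sel_str^{ur}(ℚ,W)·#E(ℚ_p)[p^∞]/#E(ℚ)[p^∞]` ((14.14.2) + (14.9.3)) — brick (c) of the g18 memo.

References: K. Kato, Astérisque 295 (2004) (12.2.1), Thm. 12.4 (1), Thm. 14.5 (3), §14.14 (14.14.1)–(14.14.2), Lemma 14.15 [Kato2004Asterisque];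
R. Greenberg, LNM 1716 §4 Lemma 4.2 [GreenbergLNM1716].
-/

-- the summit and its single problem are both named `BirchSwinnertonDyer` (registry layout D-0017)
set_option linter.dupNamespace false
set_option autoImplicit false

noncomputable section

open scoped NumberField
open Field IsDedekindDomain WeierstrassCurve
open Literature.NumberTheory.GaloisRepresentations Literature.NumberTheory.EllipticCurves
open Literature.NumberTheory.EllipticCurves.GreenbergSelmer
open Literature.NumberTheory.EllipticCurves.Kato2004 Literature.NumberTheory.EllipticCurves.Kato2004.EulerSystemValues
open Literature.NumberTheory.EllipticCurves.IwasawaAlgebra Literature.NumberTheory.EllipticCurves.IwasawaDual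

namespace Summit.BirchSwinnertonDyer.BirchSwinnertonDyer.Theorems.KatoH2Descent

section OfData

variable (W : WeierstrassCurve ℚ) [W.IsElliptic] (p : ℕ) [Fact p.Prime]
  [ContinuousSMul ℤ_[p] (W.tateModule p)]
  {κ : ZpExtension ℚ p} {γ : absoluteGaloisGroup ℚ}

/-- **(14.14.1) as a count, on every descent package**: `#J.H2[T] = #(H¹(ℤ[1/p],T_pW)/proj₀(𝐇¹_Γ/T))`
(tree `IwasawaH2Data.descentCokernelEquiv`). [cite: Kato2004Asterisque, §14.14 (14.14.1) (p. 243)] -/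
theorem natCard_invariants_H2_eq_natCard_descentCokernel {I : IwasawaH1Data W p κ γ} (J : IwasawaH2Data W p κ γ I) :
    Nat.card (invariants p J.H2) = Nat.card I.descentCokernel :=
  (Nat.card_congr J.descentCokernelEquiv.toEquiv).symm

variable [Finite W.toAffine.Point] [Finite (AddCommGroup.primaryComponent W.sha p)]

/-- **Kato's Thm. 14.5 (3) `#𝐇²_Γ ≤ [A : z]` on every descent package receiving `X₀` with finite cokernel.**  Rank-0 row, cyclotomic
`(κ, γ)`, pinned `I = 𝐇¹_Γ(T_pW)`, fine dual datum `Y` with `Sel₀(W/ℚ_∞)[p]` finite, `s ∈ 𝐇¹_Γ` with `proj₀ s` of infinite order,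
`char_Λ(𝐇¹_Γ/Λs) ⊆ char_Λ X₀` (any source), `J : IwasawaH2Data W p κ γ I` and an injective `Λ`-linear `e : X₀ → J.H2` with finite cokernel:
**`#(J.H2/T·J.H2) ∣ [H¹(ℤ[1/p],T_pW) : ℤ_p s₀]`** (the (14.14.1) count being supplied by the package,
`natCard_invariants_H2_eq_natCard_descentCokernel`).  With `#(𝐇²/T) = #H²(ℤ[1/p],T)` ((14.14.2)) this is Thm. 14.5 (3) verbatim.
[cite: Kato2004Asterisque, Thm. 14.5 (3) (p. 236), §14.14 (14.14.1)–(14.14.2) and Lemma 14.15 (pp. 243–244)]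
[cite: GreenbergLNM1716, §4 Lemma 4.2 (p. 102)] -/
theorem natCard_coinvariants_H2_dvd_index_of_embedding (hκ : κ.IsCyclotomic) (hγ : κ.IsTopGenerator γ)
    (I : IwasawaH1Data W p κ γ) (Y : W.FineSelmerDualData κ γ)
    (hfinp : Set.Finite {t : W.fineSelmerInfty κ | p • t = 0}) (s : I.H) (hnt : ¬ IsOfFinAddOrder (I.proj 0 s))
    (hchar : Module.charIdeal (IwasawaAlgebra p) (I.H ⧸ Submodule.span (IwasawaAlgebra p) {s}) ≤
      Module.charIdeal (IwasawaAlgebra p) Y.X)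
    (J : IwasawaH2Data W p κ γ I) (e : Y.X →ₗ[IwasawaAlgebra p] J.H2) (he : Function.Injective e)
    [Finite (J.H2 ⧸ LinearMap.range e)] :
    Finite (coinvariants p J.H2) ∧
      Nat.card (coinvariants p J.H2) ∣
        Nat.card (integralH1 (tateRep W p) p (κ.layerSubgroup 0) ⧸
          Submodule.span ℤ_[p] {(⟨I.proj 0 s, I.proj_mem 0 s⟩ : integralH1 (tateRep W p) p (κ.layerSubgroup 0))}) := by
  haveI : Module.Finite (IwasawaAlgebra p) J.H2 := J.finite_H2
  exact natCard_coinvariants_dvd_index_of_katoH2 W p hκ hγ I Y hfinp s hnt hchar e he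
    (natCard_invariants_H2_eq_natCard_descentCokernel W p J)

/-- **The same with the (14.14.2)+(14.9.3) count supplied**: if `#(J.H2/T·J.H2) · t₀ = u · t_p` for naturals `u = #Sel_str^{ur}(ℚ,W)`,
`t_p = #E(ℚ_p)[p^∞]`, `t₀ = #E(ℚ)[p^∞]` (Kato: `𝐇²/T = H²(ℤ[1/p],T)` and (14.9.3)), then `u · t_p ∣ t₀ · [H¹(ℤ[1/p],T_pW) : ℤ_p s₀]` —
the Iwasawa-side input (vi) of crux M's ledger, exact.  Bookkeeping over the previous theorem.
[cite: Kato2004Asterisque, (14.9.3) (p. 240), §14.14 (14.14.2) (p. 243), Prop. 14.16 (2) (pp. 244–245)] -/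
theorem selStrUr_mul_dvd_of_data_count (hκ : κ.IsCyclotomic) (hγ : κ.IsTopGenerator γ)
    (I : IwasawaH1Data W p κ γ) (Y : W.FineSelmerDualData κ γ)
    (hfinp : Set.Finite {t : W.fineSelmerInfty κ | p • t = 0}) (s : I.H) (hnt : ¬ IsOfFinAddOrder (I.proj 0 s))
    (hchar : Module.charIdeal (IwasawaAlgebra p) (I.H ⧸ Submodule.span (IwasawaAlgebra p) {s}) ≤
      Module.charIdeal (IwasawaAlgebra p) Y.X)
    (J : IwasawaH2Data W p κ γ I) (e : Y.X →ₗ[IwasawaAlgebra p] J.H2) (he : Function.Injective e)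
    [Finite (J.H2 ⧸ LinearMap.range e)]
    (selStrUr torsP torsGlobal : ℕ) (hcount : Nat.card (coinvariants p J.H2) * torsGlobal = selStrUr * torsP) :
    selStrUr * torsP ∣ torsGlobal *
      Nat.card (integralH1 (tateRep W p) p (κ.layerSubgroup 0) ⧸
        Submodule.span ℤ_[p] {(⟨I.proj 0 s, I.proj_mem 0 s⟩ : integralH1 (tateRep W p) p (κ.layerSubgroup 0))}) := by
  obtain ⟨-, hdvd⟩ := natCard_coinvariants_H2_dvd_index_of_embedding W p hκ hγ I Y hfinp s hnt hchar J e he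
  rw [← hcount, mul_comm (Nat.card (coinvariants p J.H2)) torsGlobal]
  exact mul_dvd_mul_left _ hdvd

end OfData

end Summit.BirchSwinnertonDyer.BirchSwinnertonDyer.Theorems.KatoH2Descent

end
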